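import Literature.Analysis.Fourier.RadialSchwartzInterpolation
import Mathlib.Analysis.SpecialFunctions.SmoothTransition
import Mathlib.Analysis.Calculus.ContDiff.Bounds
import Mathlib.MeasureTheory.Integral.DominatedConvergence
import HarnessLib

/-!
# CKMRV interpolation, step 5: radial truncation of Schwartz functions

Sibling of `Literature/Analysis/Fourier/RadialSchwartzInterpolation.lean` (the named fact
`CKMRV2022_interpolationFormula` = Cohn–Kumar–Miller–Radchenko–Viazovska, Ann. Math. 196 (2022),
Theorem 1.7). The proof of CKMRV Lemma 2.2 begins: "Compactly supported functions are dense in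
`𝓢_rad(ℝᵈ)`, as is easily shown by multiplying by a suitable bump function." In the density-free
form of the last step of the proof of Theorem 3.1 we use the radial truncations
`f_R = χ(|x|²/R²) f` (`radialTruncate R f`, with the smooth cut-off `χ(s) = smoothTransition(2 − s)`,
`χ = 1` on `s ≤ 1`, `χ = 0` on `s ≥ 2`) only through the following proved facts:

* `radialTruncate R f` is a Schwartz function, radial if `f` is, equal to `f` on `|x| ≤ R` and
  vanishing for `|x|² ≥ 2R²`;
* its Schwartz seminorms are bounded **uniformly in `R ≥ 1`** (`exists_seminorm_radialTruncate_le`: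
  Leibniz rule + scaling of the cut-off);
* hence, with the weighted sup-norm continuity of the Fourier transform on `𝓢`
  (`exists_one_add_norm_pow_mul_norm_fourier_le`), the Fourier transforms `𝓕 f_R` decay
  polynomially uniformly in `R ≥ 1` (`exists_one_add_norm_pow_mul_norm_fourier_radialTruncate_le`);
* `𝓕 f_R(ξ) → 𝓕 f(ξ)` pointwise as `R → ∞` (dominated convergence; `tendsto_fourier_radialTruncate`).

Everything is proved; no named facts.

## References

* H. Cohn, A. Kumar, S. D. Miller, D. Radchenko, M. Viazovska, *Universal optimality of the `E₈`
  and Leech lattices and interpolation formulas*, Ann. of Math. 196 (2022), §2.3, proof of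
  Lemma 2.2 (first sentence). [CohnEtAl2019]
-/

noncomputable section

open scoped Topology ContDiff FourierTransform SchwartzMap NNReal RealInnerProductSpace
open Filter Set MeasureTheory Complex

namespace Literature.Analysis.Fourier

variable {V : Type*} [NormedAddCommGroup V] [InnerProductSpace ℝ V]

/-! ## The cut-off `χ(|x|²/R²)` -/

/-- The model cut-off `χ₁(u) = χ(|u|²)`, `χ(s) = smoothTransition(2 − s)`: smooth, `0 ≤ χ₁ ≤ 1`,
`χ₁ = 1` on `|u| ≤ 1`, `χ₁ = 0` on `|u|² ≥ 2`. [folklore] -/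
def radialCutoffOne (u : V) : ℝ := Real.smoothTransition (2 - ‖u‖ ^ 2)

/-- The cut-off at scale `R`: `χ_R(x) = χ₁(x/R) = χ(|x|²/R²)`. [folklore] -/
def radialCutoff (R : ℝ) (x : V) : ℝ := radialCutoffOne (R⁻¹ • x)

/-- `χ₁` is smooth. [folklore] -/
theorem contDiff_radialCutoffOne {n : ℕ∞} : ContDiff ℝ n (radialCutoffOne : V → ℝ) :=
  Real.smoothTransition.contDiff.comp (contDiff_const.sub (contDiff_norm_sq ℝ))

/-- `χ_R = χ₁ ∘ (R⁻¹ • ·)`. [folklore] -/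
theorem radialCutoff_eq_comp (R : ℝ) :
    (radialCutoff R : V → ℝ) = radialCutoffOne ∘ ((R⁻¹ • ContinuousLinearMap.id ℝ V : V →L[ℝ] V) : V → V) := by
  funext x; simp [radialCutoff]

/-- `χ_R` is smooth. [folklore] -/
theorem contDiff_radialCutoff (R : ℝ) {n : ℕ∞} : ContDiff ℝ n (radialCutoff R : V → ℝ) := by
  rw [radialCutoff_eq_comp]
  exact contDiff_radialCutoffOne.comp (R⁻¹ • ContinuousLinearMap.id ℝ V).contDiff

/-- `0 ≤ χ_R ≤ 1`. [folklore] -/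
theorem radialCutoff_nonneg (R : ℝ) (x : V) : 0 ≤ radialCutoff R x := Real.smoothTransition.nonneg _

/-- `χ_R ≤ 1`. [folklore] -/
theorem radialCutoff_le_one (R : ℝ) (x : V) : radialCutoff R x ≤ 1 := Real.smoothTransition.le_one _

/-- `|χ_R(x)| ≤ 1`. [folklore] -/
theorem abs_radialCutoff_le_one (R : ℝ) (x : V) : |radialCutoff R x| ≤ 1 := by
  rw [abs_of_nonneg (radialCutoff_nonneg R x)]; exact radialCutoff_le_one R x

/-- `χ_R(x) = χ(|x|²/R²)` explicitly. [folklore] -/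
theorem radialCutoff_apply {R : ℝ} (hR : 0 < R) (x : V) :
    radialCutoff R x = Real.smoothTransition (2 - ‖x‖ ^ 2 / R ^ 2) := by
  simp only [radialCutoff, radialCutoffOne, norm_smul, norm_inv, Real.norm_eq_abs, abs_of_pos hR]
  congr 1
  field_simp

/-- `χ_R = 1` on the ball `|x| ≤ R`. [folklore] -/
theorem radialCutoff_eq_one {R : ℝ} (hR : 0 < R) {x : V} (hx : ‖x‖ ≤ R) : radialCutoff R x = 1 := by
  rw [radialCutoff_apply hR]
  apply Real.smoothTransition.one_of_one_le
  have h : ‖x‖ ^ 2 / R ^ 2 ≤ 1 := by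
    rw [div_le_one (by positivity)]
    exact pow_le_pow_left₀ (norm_nonneg _) hx 2
  linarith

/-- `χ_R = 0` where `|x|² ≥ 2R²`. [folklore] -/
theorem radialCutoff_eq_zero {R : ℝ} (hR : 0 < R) {x : V} (hx : 2 * R ^ 2 ≤ ‖x‖ ^ 2) : radialCutoff R x = 0 := by
  rw [radialCutoff_apply hR]
  apply Real.smoothTransition.zero_of_nonpos
  have h : 2 ≤ ‖x‖ ^ 2 / R ^ 2 := by rw [le_div_iff₀ (by positivity)]; linarith
  linarith

/-- `χ_R` depends only on `|x|`. [folklore] -/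
theorem isRadial_radialCutoff (R : ℝ) : IsRadial (radialCutoff R : V → ℝ) := by
  intro x y h
  simp only [radialCutoff, radialCutoffOne, norm_smul, h]

/-- For fixed `x`, `χ_R(x) = 1` for all large `R`. [folklore] -/
theorem eventually_radialCutoff_eq_one (x : V) : ∀ᶠ R : ℝ in atTop, radialCutoff R x = 1 := by
  filter_upwards [eventually_ge_atTop (max ‖x‖ 1)] with R hR
  exact radialCutoff_eq_one (lt_of_lt_of_le one_pos ((le_max_right _ _).trans hR))
    ((le_max_left _ _).trans hR)

section CompactSupport

variable [FiniteDimensional ℝ V]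

/-- `χ₁` has compact support (it vanishes off the ball of radius `√2`). [folklore] -/
theorem hasCompactSupport_radialCutoffOne : HasCompactSupport (radialCutoffOne : V → ℝ) := by
  refine HasCompactSupport.intro (isCompact_closedBall (0 : V) 2) fun u hu => ?_
  simp only [Metric.mem_closedBall, dist_zero_right, not_le] at hu
  apply Real.smoothTransition.zero_of_nonpos
  nlinarith [norm_nonneg u]

/-- **Uniform bounds for the derivatives of the cut-offs:** for each `i` there is `M` with
`‖Dⁱχ_R(x)‖ ≤ M` for all `x` and all `R ≥ 1` (`Dⁱ(χ₁(x/R)) = R^{−i} (Dⁱχ₁)(x/R)`). [folklore] -/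
theorem exists_norm_iteratedFDeriv_radialCutoff_le (i : ℕ) :
    ∃ M, 0 ≤ M ∧ ∀ R : ℝ, 1 ≤ R → ∀ x : V, ‖iteratedFDeriv ℝ i (radialCutoff R) x‖ ≤ M := by
  -- a bound for `Dⁱ χ₁`
  have hcont : Continuous fun u : V => ‖iteratedFDeriv ℝ i (radialCutoffOne : V → ℝ) u‖ :=
    (contDiff_radialCutoffOne.continuous_iteratedFDeriv (mod_cast le_top)).norm
  have hcs : HasCompactSupport fun u : V => ‖iteratedFDeriv ℝ i (radialCutoffOne : V → ℝ) u‖ :=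
    (hasCompactSupport_radialCutoffOne.iteratedFDeriv (𝕜 := ℝ) i).comp_left (g := fun z => ‖z‖) norm_zero
  obtain ⟨M, hM⟩ := hcont.bddAbove_range_of_hasCompactSupport hcs
  have hM' : ∀ u : V, ‖iteratedFDeriv ℝ i (radialCutoffOne : V → ℝ) u‖ ≤ M := fun u =>
    hM (Set.mem_range_self u)
  have hM0 : 0 ≤ M := le_trans (norm_nonneg _) (hM' 0)
  refine ⟨M, hM0, fun R hR x => ?_⟩
  set L : V →L[ℝ] V := R⁻¹ • ContinuousLinearMap.id ℝ V with hL
  have hLn : ‖L‖ ≤ 1 := by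
    rw [hL]
    refine (norm_smul_le (R⁻¹) (ContinuousLinearMap.id ℝ V)).trans ?_
    rw [norm_inv, Real.norm_of_nonneg (by linarith)]
    calc R⁻¹ * ‖ContinuousLinearMap.id ℝ V‖ ≤ 1 * 1 := by
          gcongr
          · exact inv_le_one_of_one_le₀ hR
          · exact ContinuousLinearMap.norm_id_le
      _ = 1 := one_mul _
  rw [radialCutoff_eq_comp, L.iteratedFDeriv_comp_right contDiff_radialCutoffOne x (mod_cast le_top)]
  refine (ContinuousMultilinearMap.norm_compContinuousLinearMap_le _ _).trans ?_
  rw [Finset.prod_const, Finset.card_univ, Fintype.card_fin]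
  calc ‖iteratedFDeriv ℝ i radialCutoffOne (L x)‖ * ‖L‖ ^ i ≤ M * 1 ^ i := by
        gcongr
        exact hM' _
    _ = M := by rw [one_pow, mul_one]

end CompactSupport

/-! ## Truncation of Schwartz functions -/

/-- The complex-valued cut-off has temperate growth. [folklore] -/
theorem hasTemperateGrowth_radialCutoff [FiniteDimensional ℝ V] (R : ℝ) :
    (fun x : V => ((radialCutoff R x : ℝ) : ℂ)).HasTemperateGrowth :=
  Function.Complex.hasTemperateGrowth_ofReal.comp (by
    rw [radialCutoff_eq_comp]
    exact (hasCompactSupport_radialCutoffOne.hasTemperateGrowth contDiff_radialCutoffOne).comp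
      (R⁻¹ • ContinuousLinearMap.id ℝ V).hasTemperateGrowth)

variable [FiniteDimensional ℝ V]

/-- **The radial truncation** `f_R = χ(|x|²/R²) f` of a Schwartz function (CKMRV, proof of
Lemma 2.2: "multiplying by a suitable bump function"). [cite: CohnEtAl2019, §2.3 Lemma 2.2 (proof)] -/
def radialTruncate (R : ℝ) (f : 𝓢(V, ℂ)) : 𝓢(V, ℂ) :=
  SchwartzMap.smulLeftCLM ℂ (fun x : V => ((radialCutoff R x : ℝ) : ℂ)) f

/-- Values of the truncation. [folklore] -/
@[simp]
theorem radialTruncate_apply (R : ℝ) (f : 𝓢(V, ℂ)) (x : V) : radialTruncate R f x = (radialCutoff R x : ℂ) * f x := by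
  rw [radialTruncate, SchwartzMap.smulLeftCLM_apply_apply (hasTemperateGrowth_radialCutoff R), smul_eq_mul]

/-- The truncation as a function. [folklore] -/
theorem coe_radialTruncate (R : ℝ) (f : 𝓢(V, ℂ)) :
    ⇑(radialTruncate R f) = fun x : V => ((radialCutoff R x : ℝ) : ℂ) * f x :=
  funext (radialTruncate_apply R f)

/-- `f_R = f` on the ball `|x| ≤ R`. [folklore] -/
theorem radialTruncate_apply_of_norm_le {R : ℝ} (hR : 0 < R) (f : 𝓢(V, ℂ)) {x : V} (hx : ‖x‖ ≤ R) :
    radialTruncate R f x = f x := by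
  rw [radialTruncate_apply, radialCutoff_eq_one hR hx, Complex.ofReal_one, one_mul]

/-- `f_R = 0` where `|x|² ≥ 2R²`. [folklore] -/
theorem radialTruncate_apply_of_le {R : ℝ} (hR : 0 < R) (f : 𝓢(V, ℂ)) {x : V} (hx : 2 * R ^ 2 ≤ ‖x‖ ^ 2) :
    radialTruncate R f x = 0 := by
  rw [radialTruncate_apply, radialCutoff_eq_zero hR hx, Complex.ofReal_zero, zero_mul]

/-- `f_R = 0` for `|x| ≥ 2R`. [folklore] -/
theorem radialTruncate_apply_of_two_mul_le {R : ℝ} (hR : 0 < R) (f : 𝓢(V, ℂ)) {x : V} (hx : 2 * R ≤ ‖x‖) :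
    radialTruncate R f x = 0 :=
  radialTruncate_apply_of_le hR f (by nlinarith [norm_nonneg x])

/-- `|f_R(x)| ≤ |f(x)|`. [folklore] -/
theorem norm_radialTruncate_apply_le (R : ℝ) (f : 𝓢(V, ℂ)) (x : V) : ‖radialTruncate R f x‖ ≤ ‖f x‖ := by
  rw [radialTruncate_apply, norm_mul, Complex.norm_real, Real.norm_eq_abs]
  exact (mul_le_of_le_one_left (norm_nonneg _) (abs_radialCutoff_le_one R x))

/-- The truncation of a radial function is radial. [folklore] -/
theorem isRadial_radialTruncate (R : ℝ) {f : 𝓢(V, ℂ)} (hf : IsRadial f) : IsRadial (radialTruncate R f) := by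
  intro x y h
  simp only [radialTruncate_apply, isRadial_radialCutoff R h, hf h]

/-- For fixed `x`, `f_R(x) = f(x)` for all large `R`. [folklore] -/
theorem eventually_radialTruncate_apply_eq (f : 𝓢(V, ℂ)) (x : V) : ∀ᶠ R : ℝ in atTop, radialTruncate R f x = f x := by
  filter_upwards [eventually_radialCutoff_eq_one x] with R hR
  rw [radialTruncate_apply, hR, Complex.ofReal_one, one_mul]

/-! ## Uniform Schwartz seminorm bounds -/

/-- **The Schwartz seminorms of the truncations are bounded uniformly in `R ≥ 1`:**
`p_{k,n}(f_R) ≤ ∑ᵢ C(n,i) Mᵢ p_{k,n−i}(f)` (Leibniz rule, `‖Dⁱχ_R‖ ≤ Mᵢ`). [folklore] -/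
theorem exists_seminorm_radialTruncate_le (f : 𝓢(V, ℂ)) (k n : ℕ) :
    ∃ B, ∀ R : ℝ, 1 ≤ R → SchwartzMap.seminorm ℂ k n (radialTruncate R f) ≤ B := by
  choose M hM0 hM using fun i => exists_norm_iteratedFDeriv_radialCutoff_le (V := V) i
  set B : ℝ := ∑ i ∈ Finset.range (n + 1),
    (n.choose i : ℝ) * M i * SchwartzMap.seminorm ℂ k (n - i) f with hB
  have hB0 : 0 ≤ B := Finset.sum_nonneg fun i _ =>
    mul_nonneg (mul_nonneg (Nat.cast_nonneg _) (hM0 i)) (apply_nonneg _ _)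
  refine ⟨B, fun R hR => SchwartzMap.seminorm_le_bound ℂ k n _ hB0 fun x => ?_⟩
  have hg : ContDiff ℝ ∞ fun x : V => ((radialCutoff R x : ℝ) : ℂ) :=
    Complex.ofRealCLM.contDiff.comp (contDiff_radialCutoff R)
  have hLeib := norm_iteratedFDeriv_mul_le (n := n) hg (f.smooth ⊤) x (mod_cast le_top)
  rw [coe_radialTruncate]
  calc ‖x‖ ^ k * ‖iteratedFDeriv ℝ n (fun y : V => ((radialCutoff R y : ℝ) : ℂ) * f y) x‖
      ≤ ‖x‖ ^ k * ∑ i ∈ Finset.range (n + 1), (n.choose i : ℝ) *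
          ‖iteratedFDeriv ℝ i (fun y : V => ((radialCutoff R y : ℝ) : ℂ)) x‖ *
            ‖iteratedFDeriv ℝ (n - i) f x‖ := mul_le_mul_of_nonneg_left hLeib (by positivity)
    _ = ∑ i ∈ Finset.range (n + 1), (n.choose i : ℝ) *
          ‖iteratedFDeriv ℝ i (fun y : V => ((radialCutoff R y : ℝ) : ℂ)) x‖ *
            (‖x‖ ^ k * ‖iteratedFDeriv ℝ (n - i) f x‖) := by
        rw [Finset.mul_sum]; congr 1; funext i; ring
    _ ≤ B := by
        refine Finset.sum_le_sum fun i _ => ?_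
        have h1 : ‖iteratedFDeriv ℝ i (fun y : V => ((radialCutoff R y : ℝ) : ℂ)) x‖ ≤ M i := by
          have h := Complex.ofRealLI.norm_iteratedFDeriv_comp_left (f := radialCutoff R)
            ((contDiff_radialCutoff R (n := ⊤)).contDiffAt) (mod_cast le_top) (i := i) (x := x)
          rw [show (fun y : V => ((radialCutoff R y : ℝ) : ℂ)) = Complex.ofRealLI ∘ radialCutoff R from rfl, h]
          exact hM i R hR x
        have h2 : ‖x‖ ^ k * ‖iteratedFDeriv ℝ (n - i) f x‖ ≤ SchwartzMap.seminorm ℂ k (n - i) f :=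
          SchwartzMap.le_seminorm ℂ k (n - i) f x
        exact mul_le_mul (mul_le_mul_of_nonneg_left h1 (Nat.cast_nonneg _)) h2 (by positivity)
          (mul_nonneg (Nat.cast_nonneg _) (hM0 i))

/-! ## Weighted sup-norm continuity of the Fourier transform on `𝓢` -/

variable [MeasurableSpace V] [BorelSpace V]

/-- **Continuity of `𝓕 : 𝓢 → 𝓢` in weighted sup-norm form:** for each `M` there are a finite
set `s` of Schwartz seminorm indices and `C ≥ 0` with
`(1 + ‖ξ‖)ᴹ ‖𝓕ψ(ξ)‖ ≤ C · (sup_{s} p)(ψ)` for all `ψ ∈ 𝓢(V, ℂ)` and `ξ`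
(Mathlib's `Seminorm.bound_of_continuous` for the continuous seminorm
`ψ ↦ sup_{k ≤ M} p_{k,0}(𝓕ψ)`). [folklore] -/
theorem exists_one_add_norm_pow_mul_norm_fourier_le (M : ℕ) :
    ∃ (s : Finset (ℕ × ℕ)) (C : ℝ), 0 ≤ C ∧ ∀ (ψ : 𝓢(V, ℂ)) (ξ : V),
      (1 + ‖ξ‖) ^ M * ‖(𝓕 ψ : 𝓢(V, ℂ)) ξ‖ ≤ C * (s.sup (schwartzSeminormFamily ℂ V ℂ)) ψ := by
  set Fo : 𝓢(V, ℂ) →L[ℂ] 𝓢(V, ℂ) := FourierTransform.fourierCLM ℂ 𝓢(V, ℂ) with hFo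
  have hFo_apply : ∀ ψ : 𝓢(V, ℂ), Fo ψ = 𝓕 ψ := fun ψ => rfl
  set q₀ : Seminorm ℂ 𝓢(V, ℂ) := (Finset.Iic (M, 0)).sup (schwartzSeminormFamily ℂ V ℂ) with hq₀
  set q : Seminorm ℂ 𝓢(V, ℂ) := q₀.comp (Fo : 𝓢(V, ℂ) →ₗ[ℂ] 𝓢(V, ℂ)) with hq
  have hq₀c : Continuous q₀ := by
    rw [hq₀]
    exact Seminorm.continuous_finsetSup fun i _ =>
      (schwartz_withSeminorms ℂ V ℂ).continuous_seminorm i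
  have hqc : Continuous q := hq₀c.comp Fo.continuous
  obtain ⟨s, C, _, hle⟩ := Seminorm.bound_of_continuous (schwartz_withSeminorms ℂ V ℂ) q hqc
  refine ⟨s, 2 ^ M * C, by positivity, fun ψ ξ => ?_⟩
  have h1 : (1 + ‖ξ‖) ^ M * ‖(𝓕 ψ : 𝓢(V, ℂ)) ξ‖ ≤ 2 ^ M * q₀ (𝓕 ψ) := by
    have h := SchwartzMap.one_add_le_sup_seminorm_apply (𝕜 := ℂ) (m := (M, 0)) (k := M) (n := 0)
      le_rfl le_rfl (𝓕 ψ : 𝓢(V, ℂ)) ξ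
    rwa [norm_iteratedFDeriv_zero] at h
  have h2 : q₀ (𝓕 ψ) ≤ C * (s.sup (schwartzSeminormFamily ℂ V ℂ)) ψ := by
    have h := hle ψ
    simp only [hq, Seminorm.comp_apply, ContinuousLinearMap.coe_coe, hFo_apply] at h
    exact h
  calc (1 + ‖ξ‖) ^ M * ‖(𝓕 ψ : 𝓢(V, ℂ)) ξ‖ ≤ 2 ^ M * q₀ (𝓕 ψ) := h1
    _ ≤ 2 ^ M * (C * (s.sup (schwartzSeminormFamily ℂ V ℂ)) ψ) := by gcongr
    _ = 2 ^ M * C * (s.sup (schwartzSeminormFamily ℂ V ℂ)) ψ := by ring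

/-- **Uniform polynomial decay of the Fourier transforms of the truncations:** for each `M` there
is `C` with `(1 + ‖ξ‖)ᴹ ‖𝓕(f_R)(ξ)‖ ≤ C` for all `ξ` and all `R ≥ 1`. [folklore] -/
theorem exists_one_add_norm_pow_mul_norm_fourier_radialTruncate_le (f : 𝓢(V, ℂ)) (M : ℕ) :
    ∃ C, 0 ≤ C ∧ ∀ R : ℝ, 1 ≤ R → ∀ ξ : V,
      (1 + ‖ξ‖) ^ M * ‖(𝓕 (radialTruncate R f) : 𝓢(V, ℂ)) ξ‖ ≤ C := by
  obtain ⟨s, C, hC0, hC⟩ := exists_one_add_norm_pow_mul_norm_fourier_le (V := V) M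
  choose B hB using fun i : ℕ × ℕ => exists_seminorm_radialTruncate_le f i.1 i.2
  have hBnn : ∀ i, 0 ≤ B i := fun i => le_trans (apply_nonneg _ _) (hB i 1 le_rfl)
  refine ⟨C * ∑ i ∈ s, B i, mul_nonneg hC0 (Finset.sum_nonneg fun i _ => hBnn i),
    fun R hR ξ => (hC (radialTruncate R f) ξ).trans ?_⟩
  refine mul_le_mul_of_nonneg_left ?_ hC0
  exact Seminorm.finset_sup_apply_le (Finset.sum_nonneg fun i _ => hBnn i) fun i hi =>
    (hB i R hR).trans (Finset.single_le_sum (fun j _ => hBnn j) hi)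

/-! ## Pointwise convergence of the Fourier transforms -/

/-- **`𝓕(f_R)(ξ) → 𝓕f(ξ)` as `R → ∞`** (dominated convergence in the Fourier integral: the
integrand converges pointwise, since `χ_R(x) = 1` for `R ≥ |x|`, and is dominated by `|f|`).
[folklore] -/
theorem tendsto_fourier_radialTruncate (f : 𝓢(V, ℂ)) (ξ : V) :
    Tendsto (fun R : ℝ => (𝓕 (radialTruncate R f) : 𝓢(V, ℂ)) ξ) atTop (𝓝 ((𝓕 f : 𝓢(V, ℂ)) ξ)) := by
  simp only [SchwartzMap.fourier_coe, Real.fourier_eq]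
  refine tendsto_integral_filter_of_dominated_convergence (fun v => ‖f v‖) ?_ ?_ f.integrable.norm ?_
  · filter_upwards with R
    exact ((Real.fourierIntegral_convergent_iff ξ).2 (radialTruncate R f).integrable).aestronglyMeasurable
  · filter_upwards with R
    refine Eventually.of_forall fun v => ?_
    rw [Circle.norm_smul]
    exact norm_radialTruncate_apply_le R f v
  · refine Eventually.of_forall fun v => ?_
    have hev := eventually_radialTruncate_apply_eq f v
    apply Tendsto.congr' (f₁ := fun _ => 𝐞 (-⟪v, ξ⟫) • f v)
    · filter_upwards [hev] with R hR
      rw [hR]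
    · exact tendsto_const_nhds

end Literature.Analysis.Fourier
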